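import Literature.AlgebraicGeometry.Motives.MixedHodgeStructureDeligneGrading
import Literature.AlgebraicGeometry.HodgeTheory.LimitMixedHodgeStructureNMorphism
import Literature.AlgebraicGeometry.HodgeTheory.PolarizedLimitMixedHodgeStructureDuality
import Literature.AlgebraicGeometry.HodgeTheory.PolarizedLimitMixedHodgeStructureCoordinateChange
import HarnessLib

/-!
# The Deligne grading of a (polarized) limit mixed Hodge structure: `[Y, N] = -2N`, `Y - k ∈ 𝔤`

For a limit mixed Hodge structure `L = (V, W, F, N)` of weight `k` with Deligne grading `Y = Y_{(F,W)}`
(`Y = p + q` on `I^{p,q}`, `Motives/MixedHodgeStructureDeligneGrading`):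

* §1 **`deligneY_N_apply` / `deligneY_comp_N_sub_N_comp_deligneY`: `[Y, N] = -2N`** — `N` is a morphism of
  type `(-1,-1)`, `N I^{p,q} ⊆ I^{p-1,q-1}` (the tree's `map_N_deligneI_le`), so `Y N x - N Y x = -2 N x`
  (Cattani et al. §7.5 / Brosnan–Pearlstein §2.1: `N ∈ 𝔤𝔩(V)^{-1,-1}`, hence `[Y, N] = -2N`).
* §2 for a POLARIZED limit mixed Hodge structure, **`Q_baseChange_deligneY_add`:
  `Q(Yx, y) + Q(x, Yy) = 2k · Q(x, y)`**, i.e. **`Y - k·1` is an infinitesimal isometry of `Q`**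
  (`Q_baseChange_deligneY_sub_add`) — from Balnojan–Hertling Lemma 3.5 (3.9) `Q(I^{p,q}, I^{r,s}) = 0` unless
  `p + q + r + s = 2k` (the tree's `Q_baseChange_eq_zero_of_mem_deligneI_of_weight_ne`).
* §3 **Balnojan–Hertling Lemma 3.5 (3.10)**, `Q_baseChange_pow_N_eq_zero_of_primitive`: for the bigraded
  primitive parts `I_0^{p,q} = I^{p,q} ∩ ker N^{p+q-k+1}`, `Q(N^i I_0^{p,q}, N^j I_0^{r,s}) = 0` unless
  `(r, s, i+j) = (q, p, p+q-k)`; `Q_baseChange_pow_N` (`Q(N^i x, y) = (-1)^i Q(x, N^i y)`).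

Everything is proved; no named fact is introduced.

## References

* [BrosnanPearlstein2009Duke] P. Brosnan, G. Pearlstein, Duke Math. J. 150 (2009), §2.1.
* [BalnojanHertling2018] — , Lemma 3.5 (3.9).
* [CattaniElZeinGriffithsLe2014] E. Cattani et al. (eds.), *Hodge Theory* (2014), §7.5, Thm. 7.5.6.
-/

noncomputable section

open scoped TensorProduct

namespace Literature.AlgebraicGeometry.HodgeTheory

open Motives Motives.HodgeStructure Motives.MixedHodgeStructure

universe u

variable {V : Type u} [AddCommGroup V] [Module ℚ V] [FiniteDimensional ℚ V] {k : ℤ}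

namespace LimitMixedHodgeStructure

variable (L : LimitMixedHodgeStructure V k)

/-! ## §1 `[Y, N] = -2N` -/

/-- **`Y (N x) = N (Y x) - 2 N x`**: `N` lowers the Deligne grading by `2` (`N I^{p,q} ⊆ I^{p-1,q-1}`).
[cite: BrosnanPearlstein2009Duke, §2.1] [cite: CattaniElZeinGriffithsLe2014, Thm. 7.5.6] -/
theorem deligneY_N_apply (x : ℂ ⊗[ℚ] V) :
    L.toMixedHodgeStructure.deligneY (L.N.baseChange ℂ x) =
      L.N.baseChange ℂ (L.toMixedHodgeStructure.deligneY x) - (2 : ℂ) • L.N.baseChange ℂ x := by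
  have key : L.toMixedHodgeStructure.deligneY ∘ₗ L.N.baseChange ℂ =
      L.N.baseChange ℂ ∘ₗ L.toMixedHodgeStructure.deligneY - (2 : ℂ) • L.N.baseChange ℂ := by
    refine L.toMixedHodgeStructure.linearMap_eq_of_eqOn_deligneI fun p q x hx => ?_
    have hNx : L.N.baseChange ℂ x ∈ L.toMixedHodgeStructure.deligneI (p - 1) (q - 1) :=
      L.map_N_deligneI_le p q ⟨x, hx, rfl⟩
    rw [LinearMap.comp_apply, LinearMap.sub_apply, LinearMap.comp_apply, LinearMap.smul_apply,
      L.toMixedHodgeStructure.deligneY_apply_of_mem hNx, L.toMixedHodgeStructure.deligneY_apply_of_mem hx,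
      map_smul, ← sub_smul]
    congr 1
    push_cast
    ring
  exact LinearMap.congr_fun key x

/-- **`[Y, N] = -2N`** as an identity of endomorphisms of `V_ℂ`.
[cite: BrosnanPearlstein2009Duke, §2.1] [cite: CattaniElZeinGriffithsLe2014, Thm. 7.5.6] -/
theorem deligneY_comp_N_sub_N_comp_deligneY :
    L.toMixedHodgeStructure.deligneY ∘ₗ L.N.baseChange ℂ - L.N.baseChange ℂ ∘ₗ L.toMixedHodgeStructure.deligneY =
      -((2 : ℂ) • L.N.baseChange ℂ) := by
  refine LinearMap.ext fun x => ?_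
  rw [LinearMap.sub_apply, LinearMap.comp_apply, LinearMap.comp_apply, L.deligneY_N_apply, LinearMap.neg_apply,
    LinearMap.smul_apply]
  abel

end LimitMixedHodgeStructure

namespace PolarizedLimitMixedHodgeStructure

variable (L : PolarizedLimitMixedHodgeStructure V k)

/-! ## §2 `Y - k` is an infinitesimal isometry of `Q` -/

/-- **`Q_ℂ(Y x, y) + Q_ℂ(x, Y y) = 2k · Q_ℂ(x, y)`** — on `I^{p,q} × I^{r,s}` the left side is
`(p+q+r+s) Q(x,y)`, and `Q(I^{p,q}, I^{r,s}) = 0` unless `p+q+r+s = 2k` (Lemma 3.5 (3.9)).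
[cite: BalnojanHertling2018, Lemma 3.5 (3.9)] [cite: BrosnanPearlstein2009Duke, §2.1] -/
theorem Q_baseChange_deligneY_add (x y : ℂ ⊗[ℚ] V) :
    L.Q.baseChange ℂ (L.toMixedHodgeStructure.deligneY x) y +
        L.Q.baseChange ℂ x (L.toMixedHodgeStructure.deligneY y) =
      (2 * k : ℂ) * L.Q.baseChange ℂ x y := by
  set H := L.toMixedHodgeStructure with hH
  have hx : x ∈ ⨆ pq, H.deligneFamily pq := by rw [H.iSup_deligneFamily_eq_top]; exact Submodule.mem_top
  induction hx using Submodule.iSup_induction' generalizing y with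
  | mem pq x hx =>
    have hy : y ∈ ⨆ rs, H.deligneFamily rs := by rw [H.iSup_deligneFamily_eq_top]; exact Submodule.mem_top
    induction hy using Submodule.iSup_induction' with
    | mem rs y hy =>
      rw [H.deligneY_apply_of_mem (show x ∈ H.deligneI pq.1 pq.2 from hx),
        H.deligneY_apply_of_mem (show y ∈ H.deligneI rs.1 rs.2 from hy), LinearMap.map_smul₂, map_smul,
        smul_eq_mul, smul_eq_mul, ← add_mul]
      by_cases hw : pq.1 + pq.2 + rs.1 + rs.2 = 2 * k
      · congr 1
        have hw' : ((pq.1 + pq.2 + rs.1 + rs.2 : ℤ) : ℂ) = ((2 * k : ℤ) : ℂ) := by rw [hw]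
        push_cast at hw' ⊢
        linear_combination hw'
      · rw [L.Q_baseChange_eq_zero_of_mem_deligneI_of_weight_ne hw hx hy, mul_zero, mul_zero]
    | zero => simp
    | add y y' _ _ hy hy' =>
      rw [map_add, map_add, (L.Q.baseChange ℂ x).map_add, map_add, mul_add, ← hy, ← hy']
      abel
  | zero => simp
  | add x x' _ _ hx hx' =>
    rw [map_add, LinearMap.map_add₂, LinearMap.map_add₂, LinearMap.map_add₂, mul_add, ← hx y, ← hx' y]
    abel

/-- **`Y - k·1 ∈ 𝔤 = 𝔞𝔲𝔱(V_ℂ, Q)`: `Q_ℂ((Y-k) x, y) + Q_ℂ(x, (Y-k) y) = 0`.**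
[cite: BalnojanHertling2018, Lemma 3.5 (3.9)] [cite: BrosnanPearlstein2009Duke, §2.1] -/
theorem Q_baseChange_deligneY_sub_add (x y : ℂ ⊗[ℚ] V) :
    L.Q.baseChange ℂ (L.toMixedHodgeStructure.deligneY x - (k : ℂ) • x) y +
        L.Q.baseChange ℂ x (L.toMixedHodgeStructure.deligneY y - (k : ℂ) • y) = 0 := by
  rw [LinearMap.map_sub₂, LinearMap.map_smul₂, map_sub, map_smul, smul_eq_mul]
  have h := L.Q_baseChange_deligneY_add x y
  linear_combination h

/-! ## §3 Balnojan–Hertling, Lemma 3.5 (3.10): `Q(N^i I_0^{p,q}, N^j I_0^{r,s}) = 0` off the diagonal -/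

/-- `Q_ℂ(N_ℂ^i x, y) = (-1)^i Q_ℂ(x, N_ℂ^i y)` (iterate `N ∈ 𝔤`). [cite: CattaniElZeinGriffithsLe2014, Def. 7.5.9 (N ∈ 𝔤)] -/
theorem Q_baseChange_pow_N (i : ℕ) (x y : ℂ ⊗[ℚ] V) :
    L.Q.baseChange ℂ ((L.N ^ i).baseChange ℂ x) y = (-1) ^ i * L.Q.baseChange ℂ x ((L.N ^ i).baseChange ℂ y) := by
  induction i generalizing x y with
  | zero => simp
  | succ i ih =>
    have hcomm : (L.N ^ i).baseChange ℂ (L.N.baseChange ℂ y) = L.N.baseChange ℂ ((L.N ^ i).baseChange ℂ y) := by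
      rw [← LinearMap.comp_apply, ← LinearMap.baseChange_comp, ← Module.End.mul_eq_comp, ← pow_succ,
        pow_succ', Module.End.mul_eq_comp, LinearMap.baseChange_comp, LinearMap.comp_apply]
    rw [pow_succ', Module.End.mul_eq_comp, LinearMap.baseChange_comp, LinearMap.comp_apply, LinearMap.comp_apply,
      L.skew_N_baseChange, ih, hcomm, pow_succ]
    ring

/-- **Lemma 3.5 (3.10): with `I_0^{p,q} := ker(N^{p+q-k+1} : I^{p,q} → I^{k-q-1,k-p-1})` (the bigraded
primitive parts), `Q_ℂ(N^i I_0^{p,q}, N^j I_0^{r,s}) = 0` for `(r, s, i+j) ≠ (q, p, p+q-k)`** — move `N^i`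
across (`Q(N^i x, N^j y) = ± Q(x, N^{i+j} y) = ± Q(N^{i+j} x, y)`), note `N^{i+j} I^{r,s} ⊆ I^{r-i-j,s-i-j}`
and apply (3.9) (`Q(I^{p,q}, I^{r',s'}) = 0` unless `(r',s') = (k-p,k-q)`) together with the primitivity
`N^{p+q-k+1} x = 0`, `N^{r+s-k+1} y = 0`. [cite: BalnojanHertling2018, Lemma 3.5 (3.10)] -/
theorem Q_baseChange_pow_N_eq_zero_of_primitive {p q r s : ℤ} {ℓ ℓ' : ℕ} (hpq : p + q = k + ℓ)
    (hrs : r + s = k + ℓ') {x y : ℂ ⊗[ℚ] V} (hx : x ∈ L.toMixedHodgeStructure.deligneI p q)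
    (hx0 : (L.N ^ (ℓ + 1)).baseChange ℂ x = 0) (hy : y ∈ L.toMixedHodgeStructure.deligneI r s)
    (hy0 : (L.N ^ (ℓ' + 1)).baseChange ℂ y = 0) {i j : ℕ} (h : ¬((r, s) = (q, p) ∧ i + j = ℓ)) :
    L.Q.baseChange ℂ ((L.N ^ i).baseChange ℂ x) ((L.N ^ j).baseChange ℂ y) = 0 := by
  -- powers beyond the primitivity index kill `x` resp. `y`
  have hkill : ∀ {z : ℂ ⊗[ℚ] V} {m : ℕ} (t : ℕ), (L.N ^ (m + 1)).baseChange ℂ z = 0 → m + 1 ≤ t →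
      (L.N ^ t).baseChange ℂ z = 0 := by
    intro z m t hz ht
    obtain ⟨d, rfl⟩ := Nat.exists_eq_add_of_le ht
    rw [pow_add, pow_mul_comm, Module.End.mul_eq_comp, LinearMap.baseChange_comp, LinearMap.comp_apply, hz,
      map_zero]
  -- `Q(N^i x, N^j y) = (-1)^i Q(x, N^{i+j} y)`
  have hmove : L.Q.baseChange ℂ ((L.N ^ i).baseChange ℂ x) ((L.N ^ j).baseChange ℂ y) =
      (-1) ^ i * L.Q.baseChange ℂ x ((L.N ^ (i + j)).baseChange ℂ y) := by
    rw [L.Q_baseChange_pow_N, pow_add, Module.End.mul_eq_comp, LinearMap.baseChange_comp, LinearMap.comp_apply]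
  rw [hmove, mul_eq_zero]
  right
  -- case `i + j > ℓ'`: `N^{i+j} y = 0`
  by_cases hj : ℓ' + 1 ≤ i + j
  · rw [hkill (i + j) hy0 hj, map_zero]
  -- case `i + j > ℓ`: move everything onto `x`
  by_cases hi : ℓ + 1 ≤ i + j
  · have h2 : L.Q.baseChange ℂ x ((L.N ^ (i + j)).baseChange ℂ y) =
        (-1) ^ (i + j) * L.Q.baseChange ℂ ((L.N ^ (i + j)).baseChange ℂ x) y := by
      rw [L.Q_baseChange_pow_N, ← mul_assoc, ← mul_pow, neg_one_mul, neg_neg, one_pow, one_mul]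
    rw [h2, hkill (i + j) hx0 hi, map_zero, LinearMap.zero_apply, mul_zero]
  -- remaining case `i + j ≤ ℓ, ℓ'`: (3.9) for `x ∈ I^{p,q}` and `N^{i+j} y ∈ I^{r-i-j, s-i-j}`
  rw [not_le] at hj hi
  have hNy : (L.N ^ (i + j)).baseChange ℂ y ∈ L.toMixedHodgeStructure.deligneI (r - (i + j : ℕ)) (s - (i + j : ℕ)) :=
    L.map_pow_N_deligneI_le (i + j) r s ⟨y, hy, rfl⟩
  refine L.Q_baseChange_eq_zero_of_mem_deligneI ?_ hx hNy
  intro hbad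
  rw [Prod.ext_iff] at hbad
  simp only at hbad
  obtain ⟨h1, h2⟩ := hbad
  apply h
  refine ⟨?_, by omega⟩
  rw [Prod.ext_iff]
  simp only
  constructor <;> omega

end PolarizedLimitMixedHodgeStructure

end Literature.AlgebraicGeometry.HodgeTheory

end
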